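import Summits.Ventures.PercRepro.RankLevelSetLevelFiveSharpXXI
import Summits.Ventures.PercRepro.TriangleCapEightI
import Summits.Ventures.PercRepro.S2SharpCoreXQICT
import Summits.Ventures.PercRepro.S2SharpCoreXMidCT
import Summits.Ventures.PercRepro.S2CoreNineteen
import Summits.Ventures.PercRepro.S2CellsP19XQICT
import Summits.Ventures.PercRepro.S2TailP19XQICT
import Summits.Ventures.PercRepro.S2TailP19XQICTB
import Summits.Ventures.PercRepro.S2CellsP19XM

/-!
# PercRepro — THEOREM C₅ AT `20`: C-025 AT LEVEL `5` FOR EVERY `p ≥ 20` (p7, gen 7; sub-claim S2; the «20» assembly)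

The `p = 19` row of the cell map, closed by p3's TRIANGLE TABLE on top of the «21» kit: `s₃ ≤ cq3 d` (TriangleCapEightI,
`TriangleCap.core_ncard_triangles_le_cq3`: `11 / 13 / 16 / 20 / 24 / 29 / 34 / 40 / … / 216` at `ν = 7 … 28`, against
T⁺⁺⁺ = `17 / 23 / 30 / 38 / 47 / 57 / 68 / 80 / … / 353`) together with p2's unconditional `4`-circuit caps (S1CoreCapChain,
`s₄ ≤ avgChain d`) in the twice-parametrized cores (S2SharpCoreXQICT at `d ∈ {7, 9, 11, …, 28}`, S2SharpCoreXMidCT with the mid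
class explicit at `d = 8` (`N_mid = 7·C(12, 6)`, S2MidFlatsSeven) and `d = 10` (`N_mid = 136092`, S2MidFlatsTenC at `|E| = 29`));
the cobasis lever at `d = 6` (S2CellsP20C6, `c025_core_five_nineteen_six`); and the corank-`≥ 29` regime by the sizes `6 … 18`
(S2CoreNineteen). Every cell `(19, d)`, `6 ≤ d ≤ 28`, reads `≤ 0.957` (`(19, 10)`: `0.956`; `(19, 7)`: `0.960`; `(19, 12)`:
`0.951`); with T⁺⁺⁺ in place of the table the cells `(19, 7 … 14)` read `1.002 … 1.135`. Declarations:
* `S2.cellsP19XQICT` — the 20 XQICT cells dispatched (`cq3 d` / `avgChain d` evaluated by `decide`);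
* `c025_core_five_nineteen_eight / _ten` — the two cells with the mid class explicit;
* **`c025_core_five_nineteen_xx`** — the `e`-free core at level `5`, rank `19`, every corank `6 ≤ d ≤ 28`;
* **`c025_five_of_four_cq_xx_from`** — for `P ≥ 19`, level `4` for all `p ≥ P` implies level `5` for all `p ≥ P + 1`;
* **`c025_five_large_sharp20`** — UNCONDITIONAL over the landed tree: C-025 at level `5` for every `p ≥ 20` (level `4`
  from S1's `c025_four_seventeen`); `c025_five_large_sharp20'` is the `C025` spelling.
Axioms: standard. -/

open scoped Matroid

namespace PercRepro

namespace S2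

/-- **The `p = 19` XQICT cells, dispatched**: for every corank `7 ≤ d ≤ 28`, `d ∉ {8, 10}`, some slack `m ≤ 1024` with
`1024·U″(19, d) ≤ (1024 − m)·2^(d−5)·C(24, 5)` and `1024·T″(19 + d, d) ≤ m·2^(19+d)`, at `s3b = cq3 d` (p3's triangle table) and
`s4b = avgChain d` (p2's `4`-circuit cap chain). -/
theorem cellsP19XQICT (d : ℕ) (hd7 : 7 ≤ d) (hd28 : d ≤ 28) (hn8 : d ≠ 8) (hn10 : d ≠ 10) :
    ∃ m : ℕ, m ≤ 1024 ∧
      (1024 * ((((19 + d).choose 5 : ℚ) - (TriangleCap.cq3 d : ℚ) * ((19 + d - 3).choose 2 : ℚ) +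
        (((TriangleCap.cq3 d).choose 2 : ℕ) : ℚ)) +
      (∑ j ∈ Finset.range (d - 5), (Nat.choose (min 13 ((d + 6) / 2 + 1 - 2)) j : ℚ) / (((j + 1) + 3 * (j + 1).choose 2 : ℕ) : ℚ)) *
        ((TriangleCap.cq3 d * (19 + d - 3).choose 3 + S1.avgChain d * (19 + d - 4).choose 2 + (d + 4).choose 5 * (19 + d - 5) + (d + 5).choose 6 : ℕ) : ℚ) +
      ((∑ j ∈ Finset.range (d - 5), (Nat.choose (min 19 (5 + d) - 6) j : ℚ) / (((j + 1) + 3 * (j + 1).choose 2 : ℕ) : ℚ)) -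
        (∑ j ∈ Finset.range (d - 5), (Nat.choose (min 13 ((d + 6) / 2 + 1 - 2)) j : ℚ) / (((j + 1) + 3 * (j + 1).choose 2 : ℕ) : ℚ))) *
        ((min 19 (5 + d)).choose 6 : ℚ)) ≤
        ((1024 - m : ℕ) : ℚ) * 2 ^ (d - 5) * ((19 + 5).choose 5 : ℚ)) ∧
      (1024 * ((((19 + d).choose 4 : ℚ) +
      (∑ j ∈ Finset.range 6, (Nat.choose (min 5 ((d + 3) / 2 + 1 - 2)) j : ℚ) / (((j + 1) + 3 * (j + 1).choose 2 : ℕ) : ℚ)) *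
        ((TriangleCap.cq3 d * (19 + d - 3).choose 2 + S1.avgChain d * (19 + d - 4) + (d + 4).choose 5 : ℕ) : ℚ) +
      ((∑ j ∈ Finset.range 6, (Nat.choose 5 j : ℚ) / (((j + 1) + 3 * (j + 1).choose 2 : ℕ) : ℚ)) -
        (∑ j ∈ Finset.range 6, (Nat.choose (min 5 ((d + 3) / 2 + 1 - 2)) j : ℚ) / (((j + 1) + 3 * (j + 1).choose 2 : ℕ) : ℚ))) *
        ((10 : ℕ).choose 5 : ℚ)) +
      (((19 + d).choose 3 * 2 ^ 3 + (19 + d).choose 2 * 2 + (19 + d) + 1 : ℕ) : ℚ) +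
      (((19 + d).choose 5 : ℚ) + (∑ j ∈ Finset.range (d), (Nat.choose (min 13 ((d + 6) / 2 + 1 - 2)) j : ℚ) / (((j + 1) + 3 * (j + 1).choose 2 : ℕ) : ℚ)) * ((TriangleCap.cq3 d * (19 + d - 3).choose 3 + S1.avgChain d * (19 + d - 4).choose 2 + (d + 4).choose 5 * (19 + d - 5) + (d + 5).choose 6 : ℕ) : ℚ) +
        ((∑ j ∈ Finset.range (d), (Nat.choose (min 19 (5 + d) - 6) j : ℚ) / (((j + 1) + 3 * (j + 1).choose 2 : ℕ) : ℚ)) - (∑ j ∈ Finset.range (d), (Nat.choose (min 13 ((d + 6) / 2 + 1 - 2)) j : ℚ) / (((j + 1) + 3 * (j + 1).choose 2 : ℕ) : ℚ))) *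
        ((min 19 (5 + d)).choose 6 : ℚ)) +
      ((∑ j ∈ Finset.range (d + 1), (19 + d).choose j : ℕ) : ℚ)) ≤ (m : ℚ) * 2 ^ (19 + d)) := by
  interval_cases d
  · rw [show TriangleCap.cq3 7 = 11 by decide +kernel, show S1.avgChain 7 = 79 by decide +kernel]
    exact ⟨20, by norm_num, cellP19XQICT_poly_7, cellP19XQICT_tail_7⟩
  · exact absurd rfl hn8
  · rw [show TriangleCap.cq3 9 = 16 by decide +kernel, show S1.avgChain 9 = 159 by decide +kernel]
    exact ⟨48, by norm_num, cellP19XQICT_poly_9, cellP19XQICT_tail_9⟩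
  · exact absurd rfl hn10
  · rw [show TriangleCap.cq3 11 = 24 by decide +kernel, show S1.avgChain 11 = 288 by decide +kernel]
    exact ⟨105, by norm_num, cellP19XQICT_poly_11, cellP19XQICT_tail_11⟩
  · rw [show TriangleCap.cq3 12 = 29 by decide +kernel, show S1.avgChain 12 = 376 by decide +kernel]
    exact ⟨147, by norm_num, cellP19XQICT_poly_12, cellP19XQICT_tail_12⟩
  · rw [show TriangleCap.cq3 13 = 34 by decide +kernel, show S1.avgChain 13 = 483 by decide +kernel]
    exact ⟨195, by norm_num, cellP19XQICT_poly_13, cellP19XQICT_tail_13⟩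
  · rw [show TriangleCap.cq3 14 = 40 by decide +kernel, show S1.avgChain 14 = 611 by decide +kernel]
    exact ⟨252, by norm_num, cellP19XQICT_poly_14, cellP19XQICT_tail_14⟩
  · rw [show TriangleCap.cq3 15 = 47 by decide +kernel, show S1.avgChain 15 = 763 by decide +kernel]
    exact ⟨313, by norm_num, cellP19XQICT_poly_15, cellP19XQICT_tail_15⟩
  · rw [show TriangleCap.cq3 16 = 54 by decide +kernel, show S1.avgChain 16 = 942 by decide +kernel]
    exact ⟨378, by norm_num, cellP19XQICT_poly_16, cellP19XQICT_tail_16⟩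
  · rw [show TriangleCap.cq3 17 = 62 by decide +kernel, show S1.avgChain 17 = 1151 by decide +kernel]
    exact ⟨446, by norm_num, cellP19XQICT_poly_17, cellP19XQICT_tail_17⟩
  · rw [show TriangleCap.cq3 18 = 71 by decide +kernel, show S1.avgChain 18 = 1393 by decide +kernel]
    exact ⟨513, by norm_num, cellP19XQICT_poly_18, cellP19XQICT_tail_18⟩
  · rw [show TriangleCap.cq3 19 = 81 by decide +kernel, show S1.avgChain 19 = 1671 by decide +kernel]
    exact ⟨579, by norm_num, cellP19XQICT_poly_19, cellP19XQICT_tail_19⟩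
  · rw [show TriangleCap.cq3 20 = 92 by decide +kernel, show S1.avgChain 20 = 1989 by decide +kernel]
    exact ⟨641, by norm_num, cellP19XQICT_poly_20, cellP19XQICT_tail_20⟩
  · rw [show TriangleCap.cq3 21 = 104 by decide +kernel, show S1.avgChain 21 = 2350 by decide +kernel]
    exact ⟨699, by norm_num, cellP19XQICT_poly_21, cellP19XQICT_tail_21⟩
  · rw [show TriangleCap.cq3 22 = 117 by decide +kernel, show S1.avgChain 22 = 2758 by decide +kernel]
    exact ⟨752, by norm_num, cellP19XQICT_poly_22, cellP19XQICT_tail_22⟩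
  · rw [show TriangleCap.cq3 23 = 131 by decide +kernel, show S1.avgChain 23 = 3217 by decide +kernel]
    exact ⟨799, by norm_num, cellP19XQICT_poly_23, cellP19XQICT_tail_23⟩
  · rw [show TriangleCap.cq3 24 = 146 by decide +kernel, show S1.avgChain 24 = 3731 by decide +kernel]
    exact ⟨840, by norm_num, cellP19XQICT_poly_24, cellP19XQICT_tail_24⟩
  · rw [show TriangleCap.cq3 25 = 162 by decide +kernel, show S1.avgChain 25 = 4305 by decide +kernel]
    exact ⟨875, by norm_num, cellP19XQICT_poly_25, cellP19XQICT_tail_25⟩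
  · rw [show TriangleCap.cq3 26 = 179 by decide +kernel, show S1.avgChain 26 = 4942 by decide +kernel]
    exact ⟨905, by norm_num, cellP19XQICT_poly_26, cellP19XQICT_tail_26⟩
  · rw [show TriangleCap.cq3 27 = 197 by decide +kernel, show S1.avgChain 27 = 5648 by decide +kernel]
    exact ⟨930, by norm_num, cellP19XQICT_poly_27, cellP19XQICT_tail_27⟩
  · rw [show TriangleCap.cq3 28 = 216 by decide +kernel, show S1.avgChain 28 = 6427 by decide +kernel]
    exact ⟨951, by norm_num, cellP19XQICT_poly_28, cellP19XQICT_tail_28⟩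

end S2

namespace ThmN

open Set

variable {α : Type}

/-- **The `e`-free core at level `5`, rank `19`, corank `8`**: the mid spanning sets number `≤ 7·C(12, 6)`
(S2MidFlatsSeven), `s₃ ≤ 13` (p3's `cq3 8`), `s₄ ≤ 114` (p2's S1CoreCapChain), and the cell `(19, 8)` closes with the mid class
explicit (slack `39/1024`). -/
theorem c025_core_five_nineteen_eight (M : Matroid α) [M.Finite]
    (hR : M.eRank = ((19 : ℕ) : ℕ∞)) (hn : M.E.ncard = 19 + 8)
    (hfree : ∀ e ∈ M.E, ∃ A ⊆ M.E \ {e}, e ∉ M.closure A ∧ e ∉ M.closure ((M.E \ {e}) \ A)) :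
    RLS M 19 5 := by
  have hL0 : ∀ e ∈ M.E, ¬ M.IsLoop e := not_isLoop_of_free M hfree
  have hd : M.E.encard = M.eRank + 8 := by
    rw [hR, ← M.ground_finite.cast_ncard_eq, hn]
    push_cast
    ring
  have hflat' : ∀ X ⊆ M.E, M.eRk X ≤ ((5 - 1 : ℕ) : ℕ∞) → X.ncard ≤ 10 := fun X hX hr =>
    ncard_le_ten_of_eRk_le_four_of_free M hfree hX (by simpa using hr)
  have hC2 : ∀ P ⊆ M.E, M.eRk P ≤ 3 → P.ncard ≤ 6 :=
    fun P hP hr => ncard_le_six_of_eRk_le_three_of_free M hfree hP hr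
  have hC0 : ∀ X ⊆ M.E, M.eRk X ≤ 1 → X.ncard ≤ 1 := fun X hX hr => by
    have := ncard_add_one_le_two_pow_of_eRk_le M hL0 hfree 1 X hX hr
    omega
  have hmid := S2.card_spanMid_le_seven hflat' hC2 hC0 hd
  have hmid' : (S2.spanMid M 5 (min 10 (4 + 8)) ((8 + 6) / 2 + 1)).card ≤ 7 * (12).choose 6 := by
    rw [show min 10 (4 + 8) = 10 by norm_num, show (8 + 6) / 2 + 1 = 8 by norm_num]
    exact hmid
  have hs3 := TriangleCap.core_ncard_triangles_le_cq3 M hfree hd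
  rw [show TriangleCap.cq3 8 = 13 by decide] at hs3
  have hs4 := S1.ncard_fourCircuits_le_avgChain 8 M hfree hd
  rw [S1.avgChain_values.2.1] at hs4
  have key := c025_core_five_sharp_cell_xmidct M 19 8 (7 * (12).choose 6) (by norm_num) hR hn hfree 13 114 hs3 hs4 hmid'
  exact key ⟨39, by norm_num, S2.cellP19XM_poly_8, S2.cellP19XM_tail_8⟩

/-- **The `e`-free core at level `5`, rank `19`, corank `10`**: the mid spanning sets number `≤ 136,092`
(S2MidFlatsTenC, `|E| = 29 ≤ 31`), `s₃ ≤ 20` (p3's `cq3 10`), `s₄ ≤ 216` (p2's `avgChain 10`), and the cell `(19, 10)` closes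
with the mid class explicit (slack `76/1024`). -/
theorem c025_core_five_nineteen_ten (M : Matroid α) [M.Finite]
    (hR : M.eRank = ((19 : ℕ) : ℕ∞)) (hn : M.E.ncard = 19 + 10)
    (hfree : ∀ e ∈ M.E, ∃ A ⊆ M.E \ {e}, e ∉ M.closure A ∧ e ∉ M.closure ((M.E \ {e}) \ A)) :
    RLS M 19 5 := by
  have hL0 : ∀ e ∈ M.E, ¬ M.IsLoop e := not_isLoop_of_free M hfree
  have hd : M.E.encard = M.eRank + 10 := by
    rw [hR, ← M.ground_finite.cast_ncard_eq, hn]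
    push_cast
    ring
  have hs : ∀ e ∈ M.E, ∀ f ∈ M.E, e ≠ f → M.eRk {e, f} = 2 := by
    intro e he f hf hef
    have h2 : (2 : ℕ∞) ≤ M.eRk {e, f} :=
      two_le_eRk_of_two_le_ncard_of_free M hfree (pair_subset he hf) (by rw [ncard_pair hef])
    have h3 : M.eRk {e, f} ≤ 2 := by
      have := M.eRk_le_encard {e, f}
      rwa [encard_pair hef] at this
    exact le_antisymm h3 h2
  have hC1 : ∀ L ⊆ M.E, M.eRk L = 2 → L.ncard ≤ 3 :=
    fun L hL hr => ncard_le_three_of_eRk_two M hs hfree hL hr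
  have hflat' : ∀ X ⊆ M.E, M.eRk X ≤ ((5 - 1 : ℕ) : ℕ∞) → X.ncard ≤ 10 := fun X hX hr =>
    ncard_le_ten_of_eRk_le_four_of_free M hfree hX (by simpa using hr)
  have hC2 : ∀ P ⊆ M.E, M.eRk P ≤ 3 → P.ncard ≤ 6 :=
    fun P hP hr => ncard_le_six_of_eRk_le_three_of_free M hfree hP hr
  have hC0 : ∀ X ⊆ M.E, M.eRk X ≤ 1 → X.ncard ≤ 1 := fun X hX hr => by
    have := ncard_add_one_le_two_pow_of_eRk_le M hL0 hfree 1 X hX hr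
    omega
  have hmid := S2.card_spanMid_le_ten_le hC1 hflat' hC2 hC0 hd (by omega)
  have hmid' : (S2.spanMid M 5 (min 10 (4 + 10)) ((10 + 6) / 2 + 1)).card ≤ 136092 := by
    rw [show min 10 (4 + 10) = 10 by norm_num, show (10 + 6) / 2 + 1 = 9 by norm_num]
    exact hmid
  have hs3 := TriangleCap.core_ncard_triangles_le_cq3 M hfree hd
  rw [show TriangleCap.cq3 10 = 20 by decide] at hs3
  have hs4 := S1.ncard_fourCircuits_le_avgChain 10 M hfree hd
  rw [S1.avgChain_values.2.2.2.1] at hs4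
  have key := c025_core_five_sharp_cell_xmidct M 19 10 136092 (by norm_num) hR hn hfree 20 216 hs3 hs4 hmid'
  exact key ⟨76, by norm_num, S2.cellP19XM_poly_10, S2.cellP19XM_tail_10⟩

/-- **The `e`-free core at level `5`, rank `19`, every corank `6 ≤ d ≤ 28`**: `d = 6` by the cobasis lever (S2CellsP20C6),
`d = 8, 10` with the mid class explicit, every other `d` on the XQICT core with `s₃ ≤ cq3 d` and `s₄ ≤ avgChain d`. -/
theorem c025_core_five_nineteen_xx (M : Matroid α) [M.Finite] (d : ℕ)
    (hd6 : 6 ≤ d) (hd28 : d ≤ 28) (hR : M.eRank = ((19 : ℕ) : ℕ∞)) (hn : M.E.ncard = 19 + d)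
    (hfree : ∀ e ∈ M.E, ∃ A ⊆ M.E \ {e}, e ∉ M.closure A ∧ e ∉ M.closure ((M.E \ {e}) \ A)) :
    RLS M 19 5 := by
  by_cases h6 : d = 6
  · subst h6; exact c025_core_five_nineteen_six M hR hn hfree
  by_cases h8 : d = 8
  · subst h8; exact c025_core_five_nineteen_eight M hR hn hfree
  by_cases h10 : d = 10
  · subst h10; exact c025_core_five_nineteen_ten M hR hn hfree
  have hd : M.E.encard = M.eRank + d := by
    rw [hR, ← M.ground_finite.cast_ncard_eq, hn]
    push_cast
    ring
  have hs3 := TriangleCap.core_ncard_triangles_le_cq3 M hfree hd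
  have hs4 := S1.ncard_fourCircuits_le_avgChain d M hfree hd
  exact c025_core_five_sharp_cell_xqict M 19 d hd6 (by norm_num) hR hn hfree (TriangleCap.cq3 d) (S1.avgChain d) hs3 hs4
    (S2.cellsP19XQICT d (by omega) hd28 h8 h10)

/-- **THEOREM C₅, GIVEN LEVEL `4` FROM `P ≥ 19`**: level `4` for all `p ≥ P` implies level `5` for all `p ≥ P + 1`
(the `p = 19` row by `c025_core_five_nineteen_xx` / `c025_core_five_at_nineteen_big`, the `p = 20` row by the «21» kit, the rows
`p ≥ 21` by `c025_five_of_four_sharp_xxi_from`). -/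
theorem c025_five_of_four_cq_xx_from (P : ℕ) (hP : 19 ≤ P)
    (h4 : ∀ (M : Matroid α) [M.Finite] (p : ℕ), P ≤ p → RLS M p 4) :
    ∀ (M : Matroid α) [M.Finite] (p : ℕ), P + 1 ≤ p → RLS M p 5 := by
  rcases Nat.lt_or_ge P 20 with hP19 | hP20
  · have hP' : P = 19 := by omega
    subst hP'
    refine S2.rls_five_of_four_of_core 19 (by omega) h4 ?_
    intro M _ p hP' hR hbig hfree
    rcases Nat.lt_or_ge p 20 with h19 | h20
    · have hp' : p = 19 := by omega
      subst hp'
      rcases Nat.lt_or_ge M.E.ncard (19 + 29) with h | h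
      · exact c025_core_five_nineteen_xx M (M.E.ncard - 19) (by omega) (by omega) hR (by omega) hfree
      · exact c025_core_five_at_nineteen_big M (by omega) hfree
    rcases Nat.lt_or_ge p 21 with h20' | h21
    · have hp' : p = 20 := by omega
      subst hp'
      rcases Nat.lt_or_ge M.E.ncard (20 + 29) with h | h
      · exact c025_core_five_twenty_xx M (M.E.ncard - 20) (by omega) (by omega) hR (by omega) hfree
      · exact c025_core_five_at_twenty_big M (by omega) hfree
    · exact c025_five_of_four_sharp_xxi_from 20 le_rfl (fun M _ p hp => h4 M p (by omega)) M p h21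
  · exact c025_five_of_four_sharp_xxi_from P hP20 h4

/-- **THEOREM C₅ AT `20`**: every finite matroid satisfies C-025 at level `5` for every `p ≥ 20` (level `4` from S1's
`c025_four_seventeen`). -/
theorem c025_five_large_sharp20 (M : Matroid α) [M.Finite] (p : ℕ) (hp : 20 ≤ p) : RLS M p 5 :=
  c025_five_of_four_cq_xx_from 19 le_rfl (fun M _ p hp => S1.c025_four_seventeen M p (by omega)) M p hp

/-- The level-`5` statement at `p ≥ 20` in the vocabulary of `C025`. -/
theorem c025_five_large_sharp20' (M : Matroid α) [M.Finite] (p : ℕ) (hp : 20 ≤ p) :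
    phiK p 5 * ({A : Set α | A ⊆ M.E ∧ M.eRk A = (p : ℕ∞) ∧ M.eRk (M.E \ A) = (5 : ℕ∞)}.ncard : ℚ) ≤
      ({A : Set α | A ⊆ M.E ∧ (5 : ℕ∞) < M.eRk A ∧ M.eRk A < (p : ℕ∞)}.ncard : ℚ) :=
  c025_five_large_sharp20 M p hp

end ThmN

end PercRepro
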